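import Mathlib
import Summits.NavierStokesRegularity.NavierStokesRegularity.Theorems.DssFarFieldSlavingBlowupTypeIDssProfileGaussianGapTools
import HarnessLib

/-!
# The Gaussian-gap Liouville theorem for the similarity vorticity equation (file 3 of pub-ns-dss theory
  T41 / cell E32; route `DssFarFieldSlaving`, crux `BlowupTypeIDssProfile`,
  stmt-NavierStokesRegularity-0155 — SUPPORT; cell pub-ns-dss, typer seat g4, 2026-08-23; lead A129
  precision 4 (b))

HONEST FRAMING. A Liouville statement for a SLICE of profiles under an explicit perturbative budget; not
a statement about Navier–Stokes regularity; DERIVED by the cell's theory seat (EXPLICIT-THRESHOLDS T41,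
LIOUVILLE-SIDE §8 T41; red ×2: s14 (phys) + s21 (Sim dictionary); not in print as searched, LIT-COVERAGE §20/§21),
typed here in SIMILARITY VARIABLES as the analytic core of the cell's `GaussianGapTypeI`
(GaussianGapStatements.lean 7c27e69b80687da9); the Navier–Stokes wrapper is a separate file.

STATEMENT (`gaussianGap_vorticity_liouville`). Let `Ω, U : ℝ → ℝ³ → ℝ³` (similarity time `s`, space
`y`) with `C²` resp. `C¹` slices, `div U(s,·) = 0`, locally-in-`s` uniform bounds on
`Ω, DΩ, D²Ω, U, DU`, and the similarity vorticity equation holding pointwise as an `s`-derivative,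
`∂ₛΩ = ΔΩ − Ω − ½DΩ[y] − DΩ[U] + DU[Ω]` (the tree's `IsTypeIAncientMild.lerayVorticity_eq` shape).
If the stretching on the vorticity direction is `⟪DU[Ω], Ω⟫ ≤ Λ|Ω|²`, the inward radial flux is
`−⟪y, U⟫ ≤ P₋`, the Gaussian-mean vorticity fraction is `|∫KΩ|² ≤ μ₀ ∫K|Ω|²`, the Gaussian enstrophy
`Z(s) = ∫K|Ω(s)|²` is bounded, and `Λ + ¼P₋ + ½μ₀ < 3/2`, then `Ω ≡ 0` (`K = heatKernel 1`).

PROOF (theory seat's (G), typed). `Z` is differentiable (dominated differentiation) with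
`Z′ = 2∫K⟪∂ₛΩ, Ω⟫ = −2D − 2Z − ½∫K⟪y,U⟫|Ω|² + 2∫K⟪DU[Ω],Ω⟫` by the Ornstein–Uhlenbeck identity and the
transport identity of file 1 (`D = Σᵢ∫K‖DΩᵢ‖²`); the Gaussian Poincaré inequality with the mean
hypothesis gives `2D ≥ (1 − μ₀)Z`, hence `Z′ ≤ −2κZ`, `κ = 3/2 − Λ − ¼P₋ − ½μ₀ > 0`; a bounded
non-negative function with `Z′ ≤ −2κZ` on `(−∞, s₀]` vanishes (backward Grönwall,
`eq_zero_of_deriv_le_neg_mul` of file 2 = the cell's theory/BackwardGronwall.lean 62a6c73ca3e8b53c); so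
every slice has `∫K|Ω|² = 0`, i.e. `Ω ≡ 0` (file 2). [this file; theory T41]
-/

noncomputable section

set_option linter.dupNamespace false

namespace Summit.NavierStokesRegularity.NavierStokesRegularity.Theorems.GaussianGap

open Set Function Filter MeasureTheory InnerProductSpace Real Metric
open scoped RealInnerProductSpace Laplacian ContDiff Topology BigOperators
open Literature.Analysis Literature.Analysis.FluidPDE Literature.Analysis.UnboundedOperators
open Summit.NavierStokesRegularity.NavierStokesRegularity.Theorems

/-- **The Gaussian-enstrophy dissipation inequality for one slice** (the heart of T41): for
`Ω ∈ C²`, `U ∈ C¹` divergence free, with bounds `K₀` on `Ω, DΩ, D²Ω, U, DU`, stretching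
`⟪DU[Ω],Ω⟫ ≤ Λ|Ω|²`, inward flux `−⟪y,U⟫ ≤ P₋` and Gaussian mean `|∫KΩ|² ≤ μ₀∫K|Ω|²`,
`2∫K⟪Ω, ΔΩ − Ω − ½DΩ[y] − DΩ[U] + DU[Ω]⟫ ≤ −2(3/2 − Λ − ¼P₋ − ½μ₀) ∫K|Ω|²`
(Ornstein–Uhlenbeck identity + transport identity + Poincaré of file 1). [this file; theory T41 (G)] -/
theorem gaussianEnstrophy_pairing_le {Ω U : EuclideanSpace ℝ (Fin 3) → EuclideanSpace ℝ (Fin 3)}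
    {K₀ Λ Pm μ₀ : ℝ} (hΩ : ContDiff ℝ 2 Ω) (hU : ContDiff ℝ 1 U) (hdiv : VectorCalculus.IsDivFree U)
    (h0 : ∀ y, ‖Ω y‖ ≤ K₀) (h1 : ∀ y, ‖fderiv ℝ Ω y‖ ≤ K₀) (h2 : ∀ y, ‖iteratedFDeriv ℝ 2 Ω y‖ ≤ K₀)
    (h3 : ∀ y, ‖U y‖ ≤ K₀) (h4 : ∀ y, ‖fderiv ℝ U y‖ ≤ K₀)
    (hstrain : ∀ y, ⟪fderiv ℝ U y (Ω y), Ω y⟫ ≤ Λ * ‖Ω y‖ ^ 2) (hflux : ∀ y, -⟪y, U y⟫ ≤ Pm)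
    (hmean : ‖∫ y, heatKernel 1 y • Ω y‖ ^ 2 ≤ μ₀ * ∫ y, heatKernel 1 y * ‖Ω y‖ ^ 2) :
    ∫ y, heatKernel 1 y * (2 * ⟪Ω y,
        (Δ Ω) y - Ω y - (1 / 2 : ℝ) • fderiv ℝ Ω y y - fderiv ℝ Ω y (U y) + fderiv ℝ U y (Ω y)⟫) ≤
      -(2 * (3 / 2 - Λ - Pm / 4 - μ₀ / 2)) * ∫ y, heatKernel 1 y * ‖Ω y‖ ^ 2 := by
  have hK0 : 0 ≤ K₀ := (norm_nonneg _).trans (h0 0)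
  have hΩ1 : ContDiff ℝ 1 Ω := hΩ.of_le (by norm_num)
  have cK : Continuous (heatKernel (E := EuclideanSpace ℝ (Fin 3)) 1) := continuous_heatKernel 1
  have cΩ : Continuous Ω := hΩ.continuous
  have cU : Continuous U := hU.continuous
  have cDΩ : Continuous (fderiv ℝ Ω) := hΩ.continuous_fderiv (by norm_num)
  have cDU : Continuous (fderiv ℝ U) := hU.continuous_fderiv one_ne_zero
  have cΔ : Continuous (Δ Ω) := continuous_laplacian hΩ
  have c5 : Continuous fun y => fderiv ℝ Ω y y := cDΩ.clm_apply continuous_id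
  have c6 : Continuous fun y => fderiv ℝ Ω y (U y) := cDΩ.clm_apply cU
  have c7 : Continuous fun y => fderiv ℝ U y (Ω y) := cDU.clm_apply cΩ
  have c8 : Continuous fun y => (1 / 2 : ℝ) • fderiv ℝ Ω y y := c5.const_smul (1 / 2 : ℝ)
  -- the three identities / inequalities of file 1
  have hOU := integral_heatKernel_inner_laplacian_sub_half_fderiv hΩ h0 h1 h2
  have hTR := integral_heatKernel_inner_convect hU hΩ1 hdiv h3 h0 h1
  have hPO := integral_heatKernel_norm_sq_sub_norm_sq_integral_le hΩ1 h0 h1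
  -- integrability of the pieces
  have iZ : Integrable fun y => heatKernel 1 y * ‖Ω y‖ ^ 2 :=
    integrable_of_le_poly_heatKernel (cK.mul (cΩ.norm.pow 2)) (C := K₀ ^ 2) (N := 0) fun y => by
      rw [Real.norm_eq_abs, abs_mul, abs_of_pos (heatKernel_one_pos y), abs_of_nonneg (by positivity),
        pow_zero, mul_one, mul_comm]
      exact mul_le_mul_of_nonneg_right (pow_le_pow_left₀ (norm_nonneg _) (h0 y) 2)
        (heatKernel_one_pos y).le
  have iOU : Integrable fun y => heatKernel 1 y * ⟪(Δ Ω) y - (1 / 2 : ℝ) • fderiv ℝ Ω y y, Ω y⟫ := by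
    refine integrable_of_le_poly_heatKernel (cK.mul ((cΔ.sub c8).inner cΩ)) (C := (3 * K₀ + K₀ / 2) * K₀)
      (N := 1) fun y => ?_
    rw [Real.norm_eq_abs, abs_mul, abs_of_pos (heatKernel_one_pos y)]
    have eΔ : ‖(Δ Ω) y‖ ≤ 3 * K₀ :=
      (norm_laplacian_le_three_mul_norm_iteratedFDeriv_two hΩ y).trans
        (mul_le_mul_of_nonneg_left (h2 y) (by norm_num))
    have e2 : ‖(1 / 2 : ℝ) • fderiv ℝ Ω y y‖ ≤ K₀ / 2 * ‖y‖ := by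
      rw [norm_smul, Real.norm_of_nonneg (by norm_num : (0:ℝ) ≤ 1 / 2)]
      have := (ContinuousLinearMap.le_opNorm (fderiv ℝ Ω y) y).trans
        (mul_le_mul_of_nonneg_right (h1 y) (norm_nonneg y))
      nlinarith
    set a : EuclideanSpace ℝ (Fin 3) := (Δ Ω) y with ha
    set c : EuclideanSpace ℝ (Fin 3) := fderiv ℝ Ω y y with hc
    set b : EuclideanSpace ℝ (Fin 3) := Ω y with hb
    have e5 : ‖a - (1 / 2 : ℝ) • c‖ ≤ (3 * K₀ + K₀ / 2) * (1 + ‖y‖) := by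
      refine (norm_sub_le _ _).trans ?_
      nlinarith [norm_nonneg y, eΔ, e2, hK0]
    have hin : |⟪a - (1 / 2 : ℝ) • c, b⟫| ≤ ‖a - (1 / 2 : ℝ) • c‖ * ‖b‖ := abs_real_inner_le_norm _ _
    have hb' : ‖b‖ ≤ K₀ := h0 y
    have hKy := (heatKernel_one_pos y).le
    calc heatKernel 1 y * |⟪a - (1 / 2 : ℝ) • c, b⟫|
        ≤ heatKernel 1 y * ((3 * K₀ + K₀ / 2) * (1 + ‖y‖) * K₀) :=
          mul_le_mul_of_nonneg_left (hin.trans (mul_le_mul e5 hb' (norm_nonneg _) (by positivity))) hKy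
      _ = (3 * K₀ + K₀ / 2) * K₀ * (1 + ‖y‖) ^ 1 * heatKernel 1 y := by ring
  have iTR : Integrable fun y => heatKernel 1 y * ⟪fderiv ℝ Ω y (U y), Ω y⟫ := by
    refine integrable_of_le_poly_heatKernel (cK.mul (c6.inner cΩ)) (C := K₀ * K₀ * K₀) (N := 0)
      fun y => ?_
    rw [Real.norm_eq_abs, abs_mul, abs_of_pos (heatKernel_one_pos y), pow_zero, mul_one]
    set d : EuclideanSpace ℝ (Fin 3) := fderiv ℝ Ω y (U y) with hd
    set b : EuclideanSpace ℝ (Fin 3) := Ω y with hb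
    have e3 : ‖d‖ ≤ K₀ * K₀ :=
      (ContinuousLinearMap.le_opNorm (fderiv ℝ Ω y) (U y)).trans (mul_le_mul (h1 y) (h3 y) (norm_nonneg _) hK0)
    have hin : |⟪d, b⟫| ≤ ‖d‖ * ‖b‖ := abs_real_inner_le_norm d b
    have hb' : ‖b‖ ≤ K₀ := h0 y
    calc heatKernel 1 y * |⟪d, b⟫| ≤ heatKernel 1 y * (K₀ * K₀ * K₀) :=
          mul_le_mul_of_nonneg_left (hin.trans (mul_le_mul e3 hb' (norm_nonneg _) (by positivity)))
            (heatKernel_one_pos y).le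
      _ = K₀ * K₀ * K₀ * heatKernel 1 y := by ring
  have iST : Integrable fun y => heatKernel 1 y * ⟪fderiv ℝ U y (Ω y), Ω y⟫ := by
    refine integrable_of_le_poly_heatKernel (cK.mul (c7.inner cΩ)) (C := K₀ * K₀ * K₀) (N := 0)
      fun y => ?_
    rw [Real.norm_eq_abs, abs_mul, abs_of_pos (heatKernel_one_pos y), pow_zero, mul_one]
    set e : EuclideanSpace ℝ (Fin 3) := fderiv ℝ U y (Ω y) with he
    set b : EuclideanSpace ℝ (Fin 3) := Ω y with hb
    have e4 : ‖e‖ ≤ K₀ * K₀ :=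
      (ContinuousLinearMap.le_opNorm (fderiv ℝ U y) (Ω y)).trans (mul_le_mul (h4 y) (h0 y) (norm_nonneg _) hK0)
    have hin : |⟪e, b⟫| ≤ ‖e‖ * ‖b‖ := abs_real_inner_le_norm e b
    have hb' : ‖b‖ ≤ K₀ := h0 y
    calc heatKernel 1 y * |⟪e, b⟫| ≤ heatKernel 1 y * (K₀ * K₀ * K₀) :=
          mul_le_mul_of_nonneg_left (hin.trans (mul_le_mul e4 hb' (norm_nonneg _) (by positivity)))
            (heatKernel_one_pos y).le
      _ = K₀ * K₀ * K₀ * heatKernel 1 y := by ring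
  have iFL : Integrable fun y => heatKernel 1 y * (⟪y, U y⟫ * ‖Ω y‖ ^ 2) := by
    refine integrable_of_le_poly_heatKernel (cK.mul ((continuous_id.inner cU).mul (cΩ.norm.pow 2)))
      (C := K₀ * K₀ ^ 2) (N := 1) fun y => ?_
    rw [Real.norm_eq_abs, abs_mul, abs_of_pos (heatKernel_one_pos y), abs_mul,
      abs_of_nonneg (by positivity : (0:ℝ) ≤ ‖Ω y‖ ^ 2)]
    have e1 : |⟪y, U y⟫| ≤ (1 + ‖y‖) * K₀ := (abs_real_inner_le_norm y (U y)).trans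
      (mul_le_mul (by linarith [norm_nonneg y]) (h3 y) (norm_nonneg _) (by linarith [norm_nonneg y]))
    have e2 : ‖Ω y‖ ^ 2 ≤ K₀ ^ 2 := pow_le_pow_left₀ (norm_nonneg _) (h0 y) 2
    have hKy := (heatKernel_one_pos y).le
    calc heatKernel 1 y * (|⟪y, U y⟫| * ‖Ω y‖ ^ 2) ≤ heatKernel 1 y * ((1 + ‖y‖) * K₀ * K₀ ^ 2) :=
          mul_le_mul_of_nonneg_left (mul_le_mul e1 e2 (by positivity) (by positivity)) hKy
      _ = K₀ * K₀ ^ 2 * (1 + ‖y‖) ^ 1 * heatKernel 1 y := by ring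
  -- expand the pairing
  have e : (fun y => heatKernel 1 y * (2 * ⟪Ω y,
      (Δ Ω) y - Ω y - (1 / 2 : ℝ) • fderiv ℝ Ω y y - fderiv ℝ Ω y (U y) + fderiv ℝ U y (Ω y)⟫)) =
      fun y => 2 * (heatKernel 1 y * ⟪(Δ Ω) y - (1 / 2 : ℝ) • fderiv ℝ Ω y y, Ω y⟫)
        - 2 * (heatKernel 1 y * ‖Ω y‖ ^ 2) - 2 * (heatKernel 1 y * ⟪fderiv ℝ Ω y (U y), Ω y⟫)
        + 2 * (heatKernel 1 y * ⟪fderiv ℝ U y (Ω y), Ω y⟫) := by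
    funext y
    rw [inner_add_right, inner_sub_right, inner_sub_right, inner_sub_right, real_inner_self_eq_norm_sq,
      inner_sub_left, real_inner_smul_right, real_inner_smul_left]
    simp only [real_inner_comm (Ω y)]
    ring
  have j1 : Integrable fun y => 2 * (heatKernel 1 y * ⟪(Δ Ω) y - (1 / 2 : ℝ) • fderiv ℝ Ω y y, Ω y⟫) :=
    iOU.const_mul 2
  have j2 : Integrable fun y => 2 * (heatKernel 1 y * ‖Ω y‖ ^ 2) := iZ.const_mul 2
  have j3 : Integrable fun y => 2 * (heatKernel 1 y * ⟪fderiv ℝ Ω y (U y), Ω y⟫) := iTR.const_mul 2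
  have j4 : Integrable fun y => 2 * (heatKernel 1 y * ⟪fderiv ℝ U y (Ω y), Ω y⟫) := iST.const_mul 2
  have j12 : Integrable fun y => 2 * (heatKernel 1 y * ⟪(Δ Ω) y - (1 / 2 : ℝ) • fderiv ℝ Ω y y, Ω y⟫)
      - 2 * (heatKernel 1 y * ‖Ω y‖ ^ 2) := j1.sub j2
  have j123 : Integrable fun y => 2 * (heatKernel 1 y * ⟪(Δ Ω) y - (1 / 2 : ℝ) • fderiv ℝ Ω y y, Ω y⟫)
      - 2 * (heatKernel 1 y * ‖Ω y‖ ^ 2) - 2 * (heatKernel 1 y * ⟪fderiv ℝ Ω y (U y), Ω y⟫) := j12.sub j3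
  have hexp : ∫ y, heatKernel 1 y * (2 * ⟪Ω y,
      (Δ Ω) y - Ω y - (1 / 2 : ℝ) • fderiv ℝ Ω y y - fderiv ℝ Ω y (U y) + fderiv ℝ U y (Ω y)⟫) =
      2 * (∫ y, heatKernel 1 y * ⟪(Δ Ω) y - (1 / 2 : ℝ) • fderiv ℝ Ω y y, Ω y⟫)
        - 2 * (∫ y, heatKernel 1 y * ‖Ω y‖ ^ 2)
        - 2 * (∫ y, heatKernel 1 y * ⟪fderiv ℝ Ω y (U y), Ω y⟫)
        + 2 * (∫ y, heatKernel 1 y * ⟪fderiv ℝ U y (Ω y), Ω y⟫) := by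
    rw [e, integral_add j123 j4, integral_sub j12 j3, integral_sub j1 j2, integral_const_mul,
      integral_const_mul, integral_const_mul, integral_const_mul]
  -- the bounds
  have bST : ∫ y, heatKernel 1 y * ⟪fderiv ℝ U y (Ω y), Ω y⟫ ≤
      Λ * ∫ y, heatKernel 1 y * ‖Ω y‖ ^ 2 := by
    rw [← integral_const_mul]
    exact integral_mono iST (iZ.const_mul Λ) fun y => by
      have := hstrain y
      have hK := (heatKernel_one_pos y).le
      show heatKernel 1 y * ⟪fderiv ℝ U y (Ω y), Ω y⟫ ≤ Λ * (heatKernel 1 y * ‖Ω y‖ ^ 2)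
      nlinarith
  have bFL : -(∫ y, heatKernel 1 y * (⟪y, U y⟫ * ‖Ω y‖ ^ 2)) ≤
      Pm * ∫ y, heatKernel 1 y * ‖Ω y‖ ^ 2 := by
    rw [← integral_neg, ← integral_const_mul]
    exact integral_mono iFL.neg (iZ.const_mul Pm) fun y => by
      have := hflux y
      have hK := (heatKernel_one_pos y).le
      have h0' : 0 ≤ heatKernel 1 y * ‖Ω y‖ ^ 2 := by positivity
      show -(heatKernel 1 y * (⟪y, U y⟫ * ‖Ω y‖ ^ 2)) ≤ Pm * (heatKernel 1 y * ‖Ω y‖ ^ 2)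
      nlinarith
  rw [hexp, hOU, hTR]
  nlinarith [bST, bFL, hPO, hmean]

/-- **The Gaussian-gap Liouville theorem for the similarity vorticity equation** (pub-ns-dss theory
T41, core form in similarity variables; pointwise budget). HONEST FRAMING: a Liouville statement for a
similarity-variable vorticity SLICE FAMILY under an explicit perturbative budget `Λ + Pm/4 + μ₀/2 < 3/2`;
class-level only through file (4); nothing here bears on NS regularity. See the module docstring for
the statement in words and the proof. Hypotheses: slice regularity (`Ω(s) ∈ C²`, `U(s) ∈ C¹`,
`div U(s) = 0`), locally-in-`s` uniform bounds on `Ω, DΩ, D²Ω, U, DU`, the vorticity equation as an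
`s`-derivative, stretching `⟪DU[Ω],Ω⟫ ≤ Λ|Ω|²`, inward flux `−⟪y,U⟫ ≤ P₋`, Gaussian mean
`|∫KΩ|² ≤ μ₀∫K|Ω|²`, bounded Gaussian enstrophy, budget `Λ + ¼P₋ + ½μ₀ < 3/2`. Conclusion: `Ω ≡ 0`.
[this file; theory T41 (EXPLICIT-THRESHOLDS / LIOUVILLE-SIDE §8), red ×2: s14 (phys) + s21 (Sim dictionary)] -/
theorem gaussianGap_vorticity_liouville
    {Ω U : ℝ → EuclideanSpace ℝ (Fin 3) → EuclideanSpace ℝ (Fin 3)} {Λ Pm μ₀ B : ℝ}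
    (hΩ2 : ∀ s, ContDiff ℝ 2 (Ω s)) (hU1 : ∀ s, ContDiff ℝ 1 (U s))
    (hdiv : ∀ s, VectorCalculus.IsDivFree (U s))
    (hbdd : ∀ s₀ : ℝ, ∃ ε > 0, ∃ K₀ : ℝ, ∀ s ∈ Ioo (s₀ - ε) (s₀ + ε), ∀ y,
      ‖Ω s y‖ ≤ K₀ ∧ ‖fderiv ℝ (Ω s) y‖ ≤ K₀ ∧ ‖iteratedFDeriv ℝ 2 (Ω s) y‖ ≤ K₀ ∧
        ‖U s y‖ ≤ K₀ ∧ ‖fderiv ℝ (U s) y‖ ≤ K₀)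
    (heq : ∀ s y, HasDerivAt (fun σ => Ω σ y)
      ((Δ (Ω s)) y - Ω s y - (1 / 2 : ℝ) • fderiv ℝ (Ω s) y y - fderiv ℝ (Ω s) y (U s y) +
        fderiv ℝ (U s) y (Ω s y)) s)
    (hstrain : ∀ s y, ⟪fderiv ℝ (U s) y (Ω s y), Ω s y⟫ ≤ Λ * ‖Ω s y‖ ^ 2)
    (hflux : ∀ s y, -⟪y, U s y⟫ ≤ Pm)
    (hmean : ∀ s, ‖∫ y, heatKernel 1 y • Ω s y‖ ^ 2 ≤ μ₀ * ∫ y, heatKernel 1 y * ‖Ω s y‖ ^ 2)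
    (hZb : ∀ s, ∫ y, heatKernel 1 y * ‖Ω s y‖ ^ 2 ≤ B)
    (hbudget : Λ + Pm / 4 + μ₀ / 2 < 3 / 2) :
    ∀ s y, Ω s y = 0 := by
  set Z : ℝ → ℝ := fun s => ∫ y, heatKernel 1 y * ‖Ω s y‖ ^ 2 with hZ_def
  set Z' : ℝ → ℝ := fun s => ∫ y, heatKernel 1 y * (2 * ⟪Ω s y,
    (Δ (Ω s)) y - Ω s y - (1 / 2 : ℝ) • fderiv ℝ (Ω s) y y - fderiv ℝ (Ω s) y (U s y) +
      fderiv ℝ (U s) y (Ω s y)⟫) with hZ'_def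
  set κ : ℝ := 3 / 2 - Λ - Pm / 4 - μ₀ / 2 with hκ
  have hκpos : 0 < κ := by rw [hκ]; linarith
  have hZd : ∀ s, HasDerivAt Z (Z' s) s := by
    intro s
    obtain ⟨ε, hε, K₀, hK⟩ := hbdd s
    exact gaussianEnstrophy_hasDerivAt hΩ2 hU1 hε hK heq
  have hineq : ∀ s, Z' s ≤ -(2 * κ) * Z s := by
    intro s
    obtain ⟨ε, hε, K₀, hK⟩ := hbdd s
    have hKs := hK s (by constructor <;> linarith)
    exact gaussianEnstrophy_pairing_le (hΩ2 s) (hU1 s) (hdiv s) (fun y => (hKs y).1)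
      (fun y => (hKs y).2.1) (fun y => (hKs y).2.2.1) (fun y => (hKs y).2.2.2.1)
      (fun y => (hKs y).2.2.2.2) (hstrain s) (hflux s) (hmean s)
  have hZ0 : ∀ s, Z s = 0 := by
    intro s
    have hnn : ∀ σ ≤ s, 0 ≤ Z σ := fun σ _ =>
      integral_nonneg fun y => mul_nonneg (heatKernel_one_pos y).le (by positivity)
    exact eq_zero_of_deriv_le_neg_mul (Z := Z) (Z' := Z') (mul_pos two_pos hκpos) hnn
      (fun σ _ => hZb σ) (fun σ _ => hZd σ) (fun σ _ => hineq σ) s le_rfl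
  intro s y
  obtain ⟨ε, hε, K₀, hK⟩ := hbdd s
  exact eq_zero_of_integral_heatKernel_mul_norm_sq_eq_zero ((hΩ2 s).continuous)
    (fun z => (hK s (by constructor <;> linarith) z).1) (hZ0 s) y

end Summit.NavierStokesRegularity.NavierStokesRegularity.Theorems.GaussianGap

end
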